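import Summits.PneNP.PneNP.Theorems.PeaTwoMemBPP.Negative.GadgetCounting
import Mathlib.Analysis.SpecialFunctions.Log.Base

/-!
# PneNP / SzkEntropy — crux `PeaTwoMemBPP` (stmt-PneNP-10778), negative side, support: the log-sum step

Route `PneNP/SzkEntropy`, crux stmt-PneNP-10778.  Second support file for `GadgetReduction.lean`:

* `prod_eq_prod_termwise` — positive naturals termwise `≤` another family with the same product are termwise equal;
* `fibProd_eq_prod_pow` — `FP(f) = ∏_z |f⁻¹ z|^{|f⁻¹ z|}`;
* `pow_sum_le_prod_pow` / `eq_of_pow_sum_eq_prod_pow` — the integer log-sum (AM–GM) inequality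
  `(Σ n)^{Σ n} ≤ ∏_x (k·n_x)^{n_x}` for `n : X → ℕ` on a `k`-element type, with equality only if every
  `k·n_x = Σ n`.  This is the equality case of `H(ξ | B) ≤ log₂ 8` in cardinality form: it is what turns
  "exact on `(μ + y₀)` and `(μ + y₀, ξ)`" into "`B ⊥ ξ`".  Only `log t ≤ t − 1` (strict off `t = 1`) is used.

References: T. Cover, J. Thomas, *Elements of Information Theory*, 2nd ed., Thm 2.6.4, Thm 2.7.1 (log-sum
inequality and its equality case).
-/

namespace Summit.PneNP.PneNP.Theorems.PeaTwoMemBPP.Negative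

open Finset Literature.InformationTheory.Entropy

/-! ### Three elementary lemmas: termwise products, regrouping, log-sum -/

/-- Positive naturals termwise below another family with the same product are termwise equal. [folklore] -/
theorem prod_eq_prod_termwise {ι : Type*} (s : Finset ι) (f g : ι → ℕ) (hpos : ∀ i ∈ s, 0 < f i)
    (hle : ∀ i ∈ s, f i ≤ g i) (heq : ∏ i ∈ s, f i = ∏ i ∈ s, g i) : ∀ i ∈ s, f i = g i := by
  by_contra h
  push Not at h
  obtain ⟨i, hi, hne⟩ := h
  have hlt : ∏ i ∈ s, f i < ∏ i ∈ s, g i :=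
    Finset.prod_lt_prod hpos hle ⟨i, hi, lt_of_le_of_ne (hle i hi) hne⟩
  exact absurd heq hlt.ne

/-- Regrouping the fibre product by values: `FP(f) = ∏_z |f⁻¹ z|^{|f⁻¹ z|}` (empty fibres contribute `0⁰ = 1`).
[folklore] -/
theorem fibProd_eq_prod_pow {ι β : Type*} [Fintype ι] [Fintype β] [DecidableEq β] (f : ι → β) :
    fibProd f = ∏ z, (Finset.univ.filter fun w => f w = z).card ^ (Finset.univ.filter fun w => f w = z).card := by
  unfold fibProd
  rw [← Finset.prod_fiberwise Finset.univ f]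
  refine Finset.prod_congr rfl fun z _ => ?_
  rw [Finset.prod_congr rfl fun v hv => by rw [fiber_univ_eq, (Finset.mem_filter.1 hv).2],
    Finset.prod_const]

section LogSum

variable {X : Type*} [Fintype X]

/-- `a·log(a/m) ≥ a − m` for `a, m > 0` (`log t ≤ t − 1` at `t = m/a`). [CoverThomas2006, Thm 2.7.1] -/
theorem mul_log_div_ge {a m : ℝ} (ha : 0 < a) (hm : 0 < m) : a - m ≤ a * Real.log (a / m) := by
  have h := Real.log_le_sub_one_of_pos (div_pos hm ha)
  have e1 : Real.log (m / a) = -Real.log (a / m) := by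
    rw [Real.log_div hm.ne' ha.ne', Real.log_div ha.ne' hm.ne']; ring
  rw [e1] at h
  have e2 : m / a - 1 = (m - a) / a := by field_simp
  rw [e2] at h
  have h' : -Real.log (a / m) * a ≤ m - a := by
    have := mul_le_mul_of_nonneg_right h ha.le
    rwa [div_mul_cancel₀ _ ha.ne'] at this
  nlinarith

/-- Strict version: `a·log(a/m) > a − m` unless `a = m`. [CoverThomas2006, Thm 2.7.1] -/
theorem mul_log_div_gt {a m : ℝ} (ha : 0 < a) (hm : 0 < m) (hne : a ≠ m) : a - m < a * Real.log (a / m) := by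
  have hne' : m / a ≠ 1 := fun h1 => hne ((div_eq_one_iff_eq ha.ne').1 h1).symm
  have h := Real.log_lt_sub_one_of_pos (div_pos hm ha) hne'
  have e1 : Real.log (m / a) = -Real.log (a / m) := by
    rw [Real.log_div hm.ne' ha.ne', Real.log_div ha.ne' hm.ne']; ring
  rw [e1] at h
  have e2 : m / a - 1 = (m - a) / a := by field_simp
  rw [e2] at h
  have h' : -Real.log (a / m) * a < m - a := by
    have := mul_lt_mul_of_pos_right h ha
    rwa [div_mul_cancel₀ _ ha.ne'] at this
  nlinarith

/-- Log-sum inequality, real form: for `n : X → ℕ`, `N = Σ n`, `k = |X| > 0`: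
`N·log N ≤ Σ_x n_x·log(k·n_x)`, and strictly if some `k·n_x ≠ N`. [CoverThomas2006, Thm 2.7.1] -/
theorem sum_mul_log_ge (n : X → ℕ) (hk : 0 < Fintype.card X) :
    (((∑ x, n x : ℕ) : ℝ) * Real.log ((∑ x, n x : ℕ) : ℝ) ≤
        ∑ x, (n x : ℝ) * Real.log ((Fintype.card X : ℝ) * n x)) ∧
    ((∃ x, Fintype.card X * n x ≠ ∑ x, n x) →
      ((∑ x, n x : ℕ) : ℝ) * Real.log ((∑ x, n x : ℕ) : ℝ) <
        ∑ x, (n x : ℝ) * Real.log ((Fintype.card X : ℝ) * n x)) := by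
  set N : ℕ := ∑ x, n x with hN
  have hkR : (0 : ℝ) < Fintype.card X := by exact_mod_cast hk
  by_cases hN0 : N = 0
  · have hn0 : ∀ x, n x = 0 := fun x => by
      have : n x ≤ N := by rw [hN]; exact Finset.single_le_sum (fun _ _ => Nat.zero_le _) (Finset.mem_univ x)
      omega
    refine ⟨?_, ?_⟩
    · simp [hN0, hn0]
    · rintro ⟨x, hx⟩
      exfalso; apply hx; rw [hn0 x, hN0, mul_zero]
  have hNpos : (0 : ℝ) < N := by exact_mod_cast Nat.pos_of_ne_zero hN0
  -- the correction term D x := 0 if n x = 0 else N / k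
  set D : X → ℝ := fun x => if n x = 0 then 0 else (N : ℝ) / Fintype.card X with hD
  have term : ∀ x, (n x : ℝ) * Real.log N + ((n x : ℝ) - D x) ≤
      (n x : ℝ) * Real.log ((Fintype.card X : ℝ) * n x) := by
    intro x
    by_cases hx : n x = 0
    · simp [hD, hx]
    · have hDx : D x = (N : ℝ) / Fintype.card X := by simp [hD, hx]
      rw [hDx]
      have hnx : (0 : ℝ) < n x := by exact_mod_cast Nat.pos_of_ne_zero hx
      have h := mul_log_div_ge hnx (div_pos hNpos hkR)
      have e : (n x : ℝ) / ((N : ℝ) / Fintype.card X) = (Fintype.card X : ℝ) * n x / N := by field_simp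
      rw [e, Real.log_div (by positivity) hNpos.ne'] at h
      nlinarith [h]
  have hNsum : ((N : ℕ) : ℝ) = ∑ x, (n x : ℝ) := by rw [hN]; push_cast; rfl
  have regroup : ∑ x, ((n x : ℝ) * Real.log N + ((n x : ℝ) - D x)) =
      (N : ℝ) * Real.log N + ((N : ℝ) - ∑ x, D x) := by
    rw [Finset.sum_add_distrib, Finset.sum_sub_distrib, ← Finset.sum_mul, ← hNsum]
  have hDle : ∀ x ∈ (Finset.univ : Finset X), D x ≤ (N : ℝ) / Fintype.card X := fun x _ => by
    by_cases hx : n x = 0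
    · simp [hD, hx]; positivity
    · simp [hD, hx]
  have hcount : ∑ x, D x ≤ N := by
    calc ∑ x, D x ≤ ∑ _x : X, (N : ℝ) / Fintype.card X := Finset.sum_le_sum hDle
      _ = N := by rw [Finset.sum_const, Finset.card_univ, nsmul_eq_mul]; field_simp
  have hsum := Finset.sum_le_sum fun x (_ : x ∈ Finset.univ) => term x
  rw [regroup] at hsum
  refine ⟨by linarith, ?_⟩
  rintro ⟨x₀, hx₀⟩
  by_cases hz : ∃ x, n x = 0
  · obtain ⟨x₁, hx₁⟩ := hz
    have hlt : D x₁ < (N : ℝ) / Fintype.card X := by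
      simp [hD, hx₁]; positivity
    have hcount' : ∑ x, D x < N := by
      calc ∑ x, D x < ∑ _x : X, (N : ℝ) / Fintype.card X :=
            Finset.sum_lt_sum hDle ⟨x₁, Finset.mem_univ _, hlt⟩
        _ = N := by rw [Finset.sum_const, Finset.card_univ, nsmul_eq_mul]; field_simp
    linarith
  · push Not at hz
    have hx0 : n x₀ ≠ 0 := hz x₀
    have hnx : (0 : ℝ) < n x₀ := by exact_mod_cast Nat.pos_of_ne_zero hx0
    have hne : (n x₀ : ℝ) ≠ (N : ℝ) / Fintype.card X := by
      intro h
      apply hx₀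
      have : (Fintype.card X : ℝ) * n x₀ = N := by rw [h]; field_simp
      exact_mod_cast this
    have h := mul_log_div_gt hnx (div_pos hNpos hkR) hne
    have e : (n x₀ : ℝ) / ((N : ℝ) / Fintype.card X) = (Fintype.card X : ℝ) * n x₀ / N := by field_simp
    rw [e, Real.log_div (by positivity) hNpos.ne'] at h
    have hDx : D x₀ = (N : ℝ) / Fintype.card X := by simp [hD, hx0]
    have term' : (n x₀ : ℝ) * Real.log N + ((n x₀ : ℝ) - D x₀) <
        (n x₀ : ℝ) * Real.log ((Fintype.card X : ℝ) * n x₀) := by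
      rw [hDx]; nlinarith [h]
    have hsum' := Finset.sum_lt_sum (fun x (_ : x ∈ Finset.univ) => term x) ⟨x₀, Finset.mem_univ _, term'⟩
    rw [regroup] at hsum'
    linarith

/-- A power `(k·n)ⁿ` of naturals is never `0` (`0⁰ = 1`). [folklore] -/
theorem mul_pow_self_ne_zero (k n : ℕ) (hk : 0 < k) : (k * n) ^ n ≠ 0 := by
  rcases Nat.eq_zero_or_pos n with h | h
  · simp [h]
  · exact pow_ne_zero _ (Nat.mul_ne_zero hk.ne' h.ne')

/-- `log ∏_x (k n_x)^{n_x} = Σ_x n_x log(k n_x)`. [folklore] -/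
theorem log_prod_mul_pow (n : X → ℕ) (hk : 0 < Fintype.card X) :
    Real.log ((∏ x, (Fintype.card X * n x) ^ (n x) : ℕ) : ℝ) =
      ∑ x, (n x : ℝ) * Real.log ((Fintype.card X : ℝ) * n x) := by
  push_cast
  rw [Real.log_prod]
  · refine Finset.sum_congr rfl fun x _ => ?_
    rw [Real.log_pow]
  · intro x _
    exact_mod_cast mul_pow_self_ne_zero _ _ hk

/-- **Integer log-sum / AM–GM**: `(Σ n)^{Σ n} ≤ ∏_x (k·n_x)^{n_x}`. [CoverThomas2006, Thm 2.7.1] -/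
theorem pow_sum_le_prod_pow (n : X → ℕ) (hk : 0 < Fintype.card X) :
    (∑ x, n x) ^ (∑ x, n x) ≤ ∏ x, (Fintype.card X * n x) ^ (n x) := by
  set N : ℕ := ∑ x, n x with hN
  rcases Nat.eq_zero_or_pos N with hN0 | hNpos
  · have hn0 : ∀ x, n x = 0 := fun x => by
      have : n x ≤ N := by rw [hN]; exact Finset.single_le_sum (fun _ _ => Nat.zero_le _) (Finset.mem_univ x)
      omega
    simp [hN0, hn0]
  · have hprod : 0 < ∏ x, (Fintype.card X * n x) ^ (n x) :=
      Finset.prod_pos fun x _ => Nat.pos_of_ne_zero (mul_pow_self_ne_zero _ _ hk)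
    have hNN : 0 < N ^ N := pow_pos hNpos N
    have h := (sum_mul_log_ge n hk).1
    rw [← hN] at h
    have hlog : Real.log ((N ^ N : ℕ) : ℝ) ≤ Real.log ((∏ x, (Fintype.card X * n x) ^ (n x) : ℕ) : ℝ) := by
      rw [log_prod_mul_pow n hk]
      push_cast
      rw [Real.log_pow]
      exact h
    have := (Real.log_le_log_iff (by exact_mod_cast hNN) (by exact_mod_cast hprod)).1 hlog
    exact_mod_cast this

/-- **Equality case**: if `(Σ n)^{Σ n} = ∏_x (k·n_x)^{n_x}` then every `k·n_x = Σ n` (the family is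
constant — a fibre meeting the `k` slices in these numbers is equidistributed). [CoverThomas2006, Thm 2.7.1] -/
theorem eq_of_pow_sum_eq_prod_pow (n : X → ℕ) (hk : 0 < Fintype.card X)
    (heq : (∑ x, n x) ^ (∑ x, n x) = ∏ x, (Fintype.card X * n x) ^ (n x)) :
    ∀ x, Fintype.card X * n x = ∑ x, n x := by
  by_contra hne
  push Not at hne
  set N : ℕ := ∑ x, n x with hN
  rcases Nat.eq_zero_or_pos N with hN0 | hNpos
  · obtain ⟨x, hx⟩ := hne
    have : n x ≤ N := by rw [hN]; exact Finset.single_le_sum (fun _ _ => Nat.zero_le _) (Finset.mem_univ x)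
    apply hx
    have hx0 : n x = 0 := by omega
    rw [hx0, hN0, mul_zero]
  · have hprod : 0 < ∏ x, (Fintype.card X * n x) ^ (n x) :=
      Finset.prod_pos fun x _ => Nat.pos_of_ne_zero (mul_pow_self_ne_zero _ _ hk)
    have hNN : 0 < N ^ N := pow_pos hNpos N
    have h := (sum_mul_log_ge n hk).2 hne
    rw [← hN] at h
    have hlog : Real.log ((N ^ N : ℕ) : ℝ) < Real.log ((∏ x, (Fintype.card X * n x) ^ (n x) : ℕ) : ℝ) := by
      rw [log_prod_mul_pow n hk]
      push_cast
      rw [Real.log_pow]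
      exact h
    have hlt := (Real.log_lt_log_iff (by exact_mod_cast hNN) (by exact_mod_cast hprod)).1 hlog
    have hlt' : N ^ N < ∏ x, (Fintype.card X * n x) ^ (n x) := by exact_mod_cast hlt
    rw [hN] at hlt'
    exact absurd heq hlt'.ne

end LogSum



end Summit.PneNP.PneNP.Theorems.PeaTwoMemBPP.Negative
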